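import Mathlib
import Summits.ValiantsHypothesis.ValiantsHypothesis.Cruxes.NNLinearDegreeCofactorHard.Lines.xc_division
import Literature.Barriers.PneNP.TSPExtensionComplexityHyperplaneBound
import Literature.Barriers.PneNP.TSPExtensionComplexityKaibelWeltge
import Literature.Barriers.PneNP.ExtendedFormulationLinearImage
import Literature.Barriers.PneNP.CorrelationPolytopeXCLowerBoundGraph

/-! # Recourse-graph chain rule for extension complexity across a Minkowski sum
(val-idea-39 g2, b124 WAVE-4, lens (b) «information complexity / common information»; crux
`stmt-ValiantsHypothesis-21181` = `FifoMatching.NNDivisionHard`, residual COR-VIRTUAL / COR-MINKOWSKI.)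

MATRIX FORM of the following geometric statement.  Let `L = {y : E y ≤ g}` be an extended formulation of
`R = P + Q` with facet set `W` (`|W| = r`), projection `π`.  A SECTION is any choice `y(b,j) ∈ L` with
`π y(b,j) = p_b + q_j` over the pairs (vertex `p_b` of `P`, vertex `q_j` of `Q`).  Its FACET-INTERACTION
matrices are `v_w(b,j) := g_w − E_w · y(b,j) ≥ 0` (one `B × J` nonnegative matrix per facet `w`), and for
every valid direction `a` of `P` (Farkas multipliers `U(a,w) ≥ 0`) one has the exact identity
`Σ_w U(a,w) v_w(b,j) = F(a,b) + G(a,j)` with `F = S_P` (slack of `P`) and `G = S_Q ≥ 0`, `G(a, j₀(a)) = 0` at a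
`Q`-maximiser.  The RECOURSE GRAPH of the section is the polytope
`Γ_y := conv {(q_j, (y(b,j))_{b ∈ B}) : j ∈ J}` — a lift of `Q` recording everything the section does.

* `interaction_collapse` (the accounting identity): nonnegative factorizations of the `v_w` through an index
  type `L` give one of `F` through `W × L`.  Hence  `xc(P) = rank₊ S_P ≤ Σ_w rank₊(v_w) ≤ r · max_w rank₊(v_w)`:
  the saving `xc(P)/xc(P+Q)` of a virtual extended formulation is paid for, facet by facet, by the
  nonnegative rank of the interaction between the `P`-vertex and the `Q`-vertex inside that facet
  (`log rank₊ v_w` ≥ the common information the facet must carry — the multiplicative currency of the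
  ENTANGLEMENT BUDGET of `EntangledLift` §5/§7).
* `graph_collapse` (the chain rule): if `v_w(b,j) = μ_w(b) + Σ_{f ∈ Φ} ν_w(b,f) σ_f(j)` with ONE common
  nonnegative right factor `σ` — which is exactly what affine Farkas delivers over a size-`|Φ|` extended
  formulation `M` of `Γ_y` (`v_w(b,·)` is an affine functional of the vertex of `Γ_y`, nonnegative at every
  vertex hence on `Γ_y` hence on `M`; `σ_f(j)` = slack of facet `f` of `M` at a preimage of vertex `j`) — then
  `rank₊ F ≤ r (|Φ| + 1)`.  Geometrically:  **xc(P) ≤ xc(P+Q) · (xc(Γ) + 1) for EVERY extended formulation of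
  `P + Q`, EVERY section `y` and every polytope `Γ` with `vert-points of Γ_y ⊆ Γ ⊆ Λ`**, `Λ := {(q, Y) : q ∈ Q,
  Y_b ∈ L over p_b + q ∀ b}` the feasible-recourse bundle (the functionals `(q,Y) ↦ g_w − E_w Y_b` are nonnegative
  on all of `Λ`; `Γ = Γ_y` is one admissible choice; xc is not monotone under sub-polytopes, hence the sandwich) —
  extension complexity obeys a chain rule across Minkowski sums, the conditional term being the extension
  complexity of the recourse.
  Instances: `Γ_y` is an affine image of the simplex `Δ_J` always (`xc ≤ #vert Q`: PROP A of `xc_division`);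
  of `Q` itself when the recourse is affine in `q` (`xc(Γ_y) = xc(Q) ≤ s`: val-idea-43's `AffineDeVirt`); of a
  lift `L'` of `Q` when the recourse is affine over `L'`; and `Γ = conv ⋃_i graph_i(Q) ⊆ Λ`, `xc ≤ m(s+1)` (Balas),
  when the recourse is served by `m` globally feasible affine policies (43's adaptivity bound).
* `generator_collapse`: the trivial instance `L = J`.

NECESSARY CONDITION on any enemy of COR-VIRTUAL (`P = COR(K_h)`, `xc(P) ≥ 1.5^h`, budget `T = 2^{polylog h}`):
every section of every size-`T` extended formulation of `COR(K_h) + Q` has a recourse graph with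
`xc(Γ_y) ≥ 1.5^h / T − 1` — the lift must re-create a polytope as hard as `COR(K_h)` itself out of the
passenger's vertices and its own recourse.  Nothing here is the LAW; 21181 OPEN; VP≠VNP NOT proved. -/

namespace Summit.ValiantsHypothesis.ValiantsHypothesis.Cruxes.NNDivisionHard.RecourseGraph

/-- **INTERACTION COLLAPSE (exact accounting).**  If the augmented slack `F(a,b) + G(a,j)` (`G` with a zero in
every row) has a nonnegative factorization `Σ_w U(a,w) v_w(b,j)` and every facet-interaction matrix `v_w` has a
nonnegative factorization `v_w(b,j) = Σ_{l ∈ L} α_w(l,b) β_w(l,j)`, then `F` has a nonnegative factorization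
indexed by `W × L`.  (`rank₊ F ≤ Σ_w rank₊ v_w`.) -/
theorem interaction_collapse {A B J W L : Type} [Fintype W] [Fintype L]
    (F : A → B → ℝ) (G : A → J → ℝ) (U : A → W → ℝ) (v : W → B → J → ℝ)
    (α : W → L → B → ℝ) (β : W → L → J → ℝ)
    (hU : ∀ a w, 0 ≤ U a w) (hα : ∀ w l b, 0 ≤ α w l b) (hβ : ∀ w l j, 0 ≤ β w l j)
    (hG0 : ∀ a, ∃ j, G a j = 0)
    (hfac : ∀ w b j, v w b j = ∑ l, α w l b * β w l j)
    (hsum : ∀ a b j, ∑ w, U a w * v w b j = F a b + G a j) :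
    ∃ (U' : A → W × L → ℝ) (V' : W × L → B → ℝ),
      (∀ a p, 0 ≤ U' a p) ∧ (∀ p b, 0 ≤ V' p b) ∧ ∀ a b, ∑ p, U' a p * V' p b = F a b := by
  classical
  choose j₀ hj₀ using hG0
  refine ⟨fun a p => U a p.1 * β p.1 p.2 (j₀ a), fun p b => α p.1 p.2 b,
    fun a p => mul_nonneg (hU a p.1) (hβ p.1 p.2 (j₀ a)), fun p b => hα p.1 p.2 b, fun a b => ?_⟩
  calc ∑ p : W × L, U a p.1 * β p.1 p.2 (j₀ a) * α p.1 p.2 b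
      = ∑ w, U a w * ∑ l, α w l b * β w l (j₀ a) := by
        rw [Fintype.sum_prod_type]
        refine Finset.sum_congr rfl fun w _ => ?_
        rw [Finset.mul_sum]
        exact Finset.sum_congr rfl fun l _ => by ring
    _ = ∑ w, U a w * v w b (j₀ a) := Finset.sum_congr rfl fun w _ => by rw [hfac]
    _ = F a b + G a (j₀ a) := hsum a b (j₀ a)
    _ = F a b := by rw [hj₀, add_zero]

/-- **RECOURSE-GRAPH CHAIN RULE (matrix form).**  If every facet-interaction matrix is a constant column plus a
nonnegative combination of ONE common family of nonnegative rows `σ_f`, `f ∈ Φ` — the facet slacks of an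
extended formulation of the recourse-graph polytope `Γ_y` at the lifted vertices of `Q` — then `F` has a
nonnegative factorization indexed by `W × Option Φ`:  `xc(P) ≤ xc(P+Q) · (xc(Γ_y) + 1)`. -/
theorem graph_collapse {A B J W Φ : Type} [Fintype W] [Fintype Φ]
    (F : A → B → ℝ) (G : A → J → ℝ) (U : A → W → ℝ) (v : W → B → J → ℝ)
    (μ : W → B → ℝ) (ν : W → B → Φ → ℝ) (σ : Φ → J → ℝ)
    (hU : ∀ a w, 0 ≤ U a w) (hμ : ∀ w b, 0 ≤ μ w b) (hν : ∀ w b f, 0 ≤ ν w b f)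
    (hσ : ∀ f j, 0 ≤ σ f j) (hG0 : ∀ a, ∃ j, G a j = 0)
    (hfac : ∀ w b j, v w b j = μ w b + ∑ f, ν w b f * σ f j)
    (hsum : ∀ a b j, ∑ w, U a w * v w b j = F a b + G a j) :
    ∃ (U' : A → W × Option Φ → ℝ) (V' : W × Option Φ → B → ℝ),
      (∀ a p, 0 ≤ U' a p) ∧ (∀ p b, 0 ≤ V' p b) ∧ ∀ a b, ∑ p, U' a p * V' p b = F a b := by
  classical
  refine interaction_collapse F G U v
    (fun w o b => o.elim (μ w b) (fun f => ν w b f)) (fun w o j => o.elim 1 (fun f => σ f j))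
    hU ?_ ?_ hG0 ?_ hsum
  · intro w o b
    cases o with
    | none => exact hμ w b
    | some f => exact hν w b f
  · intro w o j
    cases o with
    | none => exact zero_le_one
    | some f => exact hσ f j
  · intro w b j
    rw [hfac, Fintype.sum_option]
    simp [Option.elim_none, Option.elim_some]

/-- **GENERATOR COLLAPSE** (the trivial instance `L = J`: PROP A shape, `xc(P) ≤ xc(P+Q) · #vert Q`). -/
theorem generator_collapse {A B J W : Type} [Fintype W] [Fintype J] [DecidableEq J]
    (F : A → B → ℝ) (G : A → J → ℝ) (U : A → W → ℝ) (v : W → B → J → ℝ)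
    (hU : ∀ a w, 0 ≤ U a w) (hv : ∀ w b j, 0 ≤ v w b j) (hG0 : ∀ a, ∃ j, G a j = 0)
    (hsum : ∀ a b j, ∑ w, U a w * v w b j = F a b + G a j) :
    ∃ (U' : A → W × J → ℝ) (V' : W × J → B → ℝ),
      (∀ a p, 0 ≤ U' a p) ∧ (∀ p b, 0 ≤ V' p b) ∧ ∀ a b, ∑ p, U' a p * V' p b = F a b := by
  classical
  refine interaction_collapse F G U v (fun w l b => v w b l) (fun w l j => if l = j then 1 else 0)
    hU (fun w l b => hv w b l) (fun w l j => by split_ifs <;> norm_num) hG0 ?_ hsum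
  intro w b j
  simp [mul_ite, Finset.sum_ite_eq']

/-- **SIZE BOOKKEEPING.**  The index types above have the advertised cardinalities. -/
theorem card_index (W L Φ : Type) [Fintype W] [Fintype L] [Fintype Φ] :
    Fintype.card (W × L) = Fintype.card W * Fintype.card L ∧
    Fintype.card (W × Option Φ) = Fintype.card W * (Fintype.card Φ + 1) := by
  simp [Fintype.card_prod, Fintype.card_option]


/-! ## §2 The chain rule in COR currency (flat `corPolytope n`): N9 as a theorem shape.
If EVERY nonnegative factorization of the augmented clique-row slack of `COR(n) + Q` (rows `udRow a ≤ 1 + m a`,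
columns `udPt b + q j`; the factorization Yannakakis/Farkas extracts from a size-`r` EF has `r + 1` terms) has
column-factor blocks `T(·,(b,j))_i` of nonnegative rank `≤ t` as `vert COR × vert Q` matrices, then
`3ⁿ ≤ (r+1)·t·2ⁿ`.  Contrapositive = N9: a size-`r` EF with `(r+1)·t < 1.5ⁿ` has, in every such factorization,
a term `i` whose interaction block has nonnegative rank `> t`. -/

open Matrix Finset
open Literature.Barriers.PneNP (HasEFOfSize three_pow_le_card_mul_two_pow_of_cover_univ)
open Literature.Combinatorics.Optimization.FixedSizePsdRank (corPolytope)
open Summit.ValiantsHypothesis.ValiantsHypothesis.Cruxes.NNLinearDegreeCofactorHard.XcDivision (udRow udPt ud_data)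
open scoped Pointwise

/-- **N9, pure matrix form (no extended formulation needed).**  ANY nonnegative factorization, through an
index type `I`, of the augmented clique-row slack `(1 + m a) − udRow a ⬝ (udPt b + q j)` of `COR(n)` plus passenger
points `q j` (row values `m a` attained at some `q j`), whose column-factor blocks `(b,j) ↦ T (b,j) i` all factor
nonnegatively through `Fin t`, forces `3ⁿ ≤ |I|·t·2ⁿ`.  In particular (every section of every lift gives such a
factorization with `|I| = r+1`): a lift with `(r+1)·t < 1.5ⁿ` has, for EVERY section, a facet block of `rank₊ > t`. -/
theorem three_pow_le_of_interaction {n t : ℕ} {I J : Type} [Fintype I] [Fintype J]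
    (q : J → Fin (n * n) → ℝ) (m : Finset (Fin n) → ℝ) (hmax : ∀ a, ∃ j, udRow a ⬝ᵥ q j = m a)
    (U : Finset (Fin n) → I → ℝ) (T : Finset (Fin n) × J → I → ℝ)
    (hU : ∀ a i, 0 ≤ U a i)
    (hfacR : ∀ a b j, (1 + m a) - udRow a ⬝ᵥ (udPt b + q j) = ∑ i, U a i * T (b, j) i)
    (α : I → Fin t → Finset (Fin n) → ℝ) (β : I → Fin t → J → ℝ)
    (hα : ∀ i l b, 0 ≤ α i l b) (hβ : ∀ i l j, 0 ≤ β i l j)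
    (hαβ : ∀ i b j, T (b, j) i = ∑ l, α i l b * β i l j) :
    3 ^ n ≤ Fintype.card I * t * 2 ^ n := by
  classical
  obtain ⟨-, -, slack, -⟩ := ud_data n
  -- the chain rule, matrix form
  obtain ⟨U', V', hU', hV', hF⟩ := interaction_collapse
    (fun a b => 1 - udRow a ⬝ᵥ udPt b) (fun a j => m a - udRow a ⬝ᵥ q j) U (fun i b j => T (b, j) i) α β
    hU hα hβ (fun a => by obtain ⟨j, hj⟩ := hmax a; exact ⟨j, by rw [hj, sub_self]⟩) hαβ
    (fun a b j => by rw [← hfacR a b j, dotProduct_add]; ring)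
  -- rectangle cover of the UDISJ support by the `|I|·t` rank-one terms
  have key := three_pow_le_card_mul_two_pow_of_cover_univ (α := Fin n)
    (Finset.univ : Finset (I × Fin t))
    (fun p => {a | 0 < U' a p}) (fun p => {b | 0 < V' p b}) ?_ ?_
  · simpa [Fintype.card_fin, Fintype.card_prod, mul_comm, mul_assoc, mul_left_comm] using key
  · -- no rectangle contains a pair with `|a ∩ b| = 1` (there the UDISJ slack vanishes)
    intro p _ a ha b hb hone
    have hab : 0 < U' a p * V' p b := mul_pos ha hb
    have hle : U' a p * V' p b ≤ ∑ p', U' a p' * V' p' b :=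
      Finset.single_le_sum (fun p' _ => mul_nonneg (hU' a p') (hV' p' b)) (Finset.mem_univ p)
    have hzero : ∑ p', U' a p' * V' p' b = 0 := by
      rw [hF, slack, hone]; norm_num
    linarith
  · -- every disjoint pair is covered (there the UDISJ slack is `1`)
    intro a b hab
    have hone : ∑ p', U' a p' * V' p' b = 1 := by
      rw [hF, slack, Finset.disjoint_iff_inter_eq_empty.1 hab, Finset.card_empty]; norm_num
    by_contra hcon
    push Not at hcon
    have hz : ∀ p', U' a p' * V' p' b = 0 := by
      intro p'
      have h1 := hU' a p'
      have h2 := hV' p' b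
      by_cases hp : 0 < U' a p'
      · have : ¬ 0 < V' p' b := fun hb => hcon p' (Finset.mem_univ _) hp hb
        have : V' p' b = 0 := le_antisymm (not_lt.1 this) h2
        rw [this, mul_zero]
      · have : U' a p' = 0 := le_antisymm (not_lt.1 hp) h1
        rw [this, zero_mul]
    have : ∑ p', U' a p' * V' p' b = 0 := Finset.sum_eq_zero fun p' _ => hz p'
    linarith

/-- **N9 in COR currency (extended-formulation form).**  If EVERY `(r+1)`-term nonnegative factorization of the
augmented clique-row slack of `COR(n) + Q` — the one `HasEFOfSize.exists_nonneg_factorization` extracts from a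
size-`r` EF included — has column-factor blocks of nonnegative rank `≤ t`, then `3ⁿ ≤ (r+1)·t·2ⁿ`. -/
theorem corPolytope_add_three_pow_le_of_interaction {n r t : ℕ} {J : Type} [Fintype J]
    {Q : Set (Fin (n * n) → ℝ)} (h : HasEFOfSize (corPolytope n + Q) r)
    (q : J → Fin (n * n) → ℝ) (hq : ∀ j, q j ∈ Q)
    (m : Finset (Fin n) → ℝ) (hm : ∀ a, ∀ y ∈ Q, udRow a ⬝ᵥ y ≤ m a)
    (hmax : ∀ a, ∃ j, udRow a ⬝ᵥ q j = m a)
    (hsec : ∀ (U : Finset (Fin n) → Option (Fin r) → ℝ) (T : Finset (Fin n) × J → Option (Fin r) → ℝ),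
        (∀ a i, 0 ≤ U a i) → (∀ p i, 0 ≤ T p i) →
        (∀ a b j, (1 + m a) - udRow a ⬝ᵥ (udPt b + q j) = ∑ i, U a i * T (b, j) i) →
        ∃ (α : Option (Fin r) → Fin t → Finset (Fin n) → ℝ) (β : Option (Fin r) → Fin t → J → ℝ),
          (∀ i l b, 0 ≤ α i l b) ∧ (∀ i l j, 0 ≤ β i l j) ∧
            ∀ i b j, T (b, j) i = ∑ l, α i l b * β i l j) :
    3 ^ n ≤ (r + 1) * t * 2 ^ n := by
  classical
  obtain ⟨pt_mem, cc_valid, -, -⟩ := ud_data n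
  -- columns `udPt b + q j ∈ COR + Q`, rows `udRow a ≤ 1 + m a` valid on the sum
  have hv : ∀ p : Finset (Fin n) × J, udPt p.1 + q p.2 ∈ corPolytope n + Q :=
    fun p => Set.add_mem_add (pt_mem p.1) (hq p.2)
  have hvalid : ∀ a, ∀ x ∈ corPolytope n + Q, udRow a ⬝ᵥ x ≤ 1 + m a := by
    rintro a x ⟨p, hp, y, hy, rfl⟩
    rw [dotProduct_add]
    exact add_le_add (cc_valid a p hp) (hm a y hy)
  obtain ⟨U, T, hU, hT, hfacR⟩ := h.exists_nonneg_factorization (fun p : Finset (Fin n) × J => udPt p.1 + q p.2)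
    hv udRow (fun a => 1 + m a) hvalid
  have hfacR' : ∀ a b j, (1 + m a) - udRow a ⬝ᵥ (udPt b + q j) = ∑ i, U a i * T (b, j) i :=
    fun a b j => hfacR a (b, j)
  obtain ⟨α, β, hα, hβ, hαβ⟩ := hsec U T hU hT hfacR'
  have key := three_pow_le_of_interaction q m hmax U T hU hfacR' α β hα hβ hαβ
  simpa [Fintype.card_option, Fintype.card_fin] using key

/-! ## §3 The wave-5 target in lens-(b) currency: the INTERACTION MATRIX LAW ⇒ COR-VIRTUAL ⇒ the crux (bridges PROVED).
The chain rule turns COR-VIRTUAL into a PURE NONNEGATIVE-RANK statement about one explicit matrix family: the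
UDISJ-plus-recourse matrices `M(a;(b,j)) = (1 − |a ∩ b|)² + G(a,j)` with a cheap, row-zeroed recourse term `G ≥ 0`.
`InteractionMatrixLaw` (OPEN; the typed target for an entropy / common-information lower bound, and a cell-sized
refutation target at `n = 3, 4`) says such an `M` never has a cheap nonnegative factorization.  PROVED here:
`corVirtualHardN_of_matrixLaw` (flat currency) and `corVirtualHard_of_matrixLaw` (graph currency: `CorVirtualHard` below is
VERBATIM the line's `XcDivision.VPLine.CorVirtualHard` = vxc(COR(K_h)) super-quasi-polynomial — restated locally only because
`Lines/virtual_passenger.lean` (rev 10) and `EntangledLift.lean` are not importable modules on the farm at this snapshot; the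
crux then follows BY NAME from the line's `VPLine.nnDivisionHard_of_corVirtual` / the seat's `route_21181_of_corVirtual'`).  The realizable case actually needed
has `G(a,j) = m_a − ⟨udRow a, q_j⟩` (a quadratic in `1_a` with coefficients `q_j`); the law is stated for general `G`
on purpose: a counterexample with non-realizable `G` would show that every proof must use the quadratic structure. -/
section MatrixLaw
open Matrix Finset
open Literature.Barriers.PneNP (HasEFOfSize corPolytope_eq_image_corPolytopeGraph_top)
open Literature.Combinatorics.Optimization (corPolytopeGraph)
open Literature.Combinatorics.Optimization.FixedSizePsdRank (corPolytope)
open Summit.ValiantsHypothesis.ValiantsHypothesis.Cruxes.NNLinearDegreeCofactorHard.XcDivision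
  (udRow udPt ud_data T dot_le_of_mem_convexHull)
open scoped Pointwise

/-- **THE INTERACTION MATRIX LAW (OPEN; wave-5 target).**  For every threshold exponent `c`, eventually in `n`: if
`G : rows(COR(n)) × J → ℝ` has a zero in every row and a nonnegative factorization through an index type of size
`≤ T c n + 1`, then every nonnegative factorization of `M(a;(b,j)) = (1 − |a ∩ b|)² + G(a,j)` uses an index type of size
`> T c n + 1`.  (`G ≥ 0` is implied by its factorization.) -/
def InteractionMatrixLaw : Prop :=
  ∀ c : ℕ, ∃ n₀ : ℕ, ∀ n ≥ n₀, ∀ (J I₁ I₂ : Type) [Fintype J] [Fintype I₁] [Fintype I₂]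
    (G : Finset (Fin n) → J → ℝ),
    (∀ a, ∃ j, G a j = 0) →
    (∃ (γ : Finset (Fin n) → I₁ → ℝ) (δ : J → I₁ → ℝ),
        (∀ a l, 0 ≤ γ a l) ∧ (∀ j l, 0 ≤ δ j l) ∧ ∀ a j, G a j = ∑ l, γ a l * δ j l) →
    (∃ (U : Finset (Fin n) → I₂ → ℝ) (V : Finset (Fin n) × J → I₂ → ℝ),
        (∀ a i, 0 ≤ U a i) ∧ (∀ p i, 0 ≤ V p i) ∧
          ∀ a b j, (1 - ((a ∩ b).card : ℝ)) ^ 2 + G a j = ∑ i, U a i * V (b, j) i) →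
    Fintype.card I₁ ≤ T c n + 1 → T c n + 1 < Fintype.card I₂

/-- COR-VIRTUAL in the flat `corPolytope n` currency. -/
def CorVirtualHardN : Prop :=
  ∀ c : ℕ, ∃ n₀ : ℕ, ∀ n ≥ n₀, ∀ (K : ℕ) (q : Fin (K + 1) → (Fin (n * n) → ℝ)) (r : ℕ),
    HasEFOfSize (corPolytope n + convexHull ℝ (Set.range q)) r →
      HasEFOfSize (convexHull ℝ (Set.range q)) r → T c n < r

/-- ★ **matrix law ⇒ COR-VIRTUAL (flat currency)**: Yannakakis twice — the recourse matrix `m_a − ⟨udRow a, q_j⟩` is a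
generalised slack matrix of `Q` (factorization through `Option (Fin r)` from `Q`'s EF), the augmented clique-row slack
of `COR + Q` factors through `Option (Fin r)` from the sum's EF, and the two add up to `(1 − |a∩b|)² + G(a,j)`. -/
theorem corVirtualHardN_of_matrixLaw (hL : InteractionMatrixLaw) : CorVirtualHardN := by
  classical
  intro c
  obtain ⟨n₀, hn₀⟩ := hL c
  refine ⟨n₀, fun n hn K q r hR hQ => ?_⟩
  obtain ⟨pt_mem, cc_valid, slack, -⟩ := ud_data n
  -- row maxima of the clique rows over the passenger's generators
  let m : Finset (Fin n) → ℝ := fun a =>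
    Finset.univ.sup' Finset.univ_nonempty (fun j : Fin (K + 1) => udRow a ⬝ᵥ q j)
  have hmax : ∀ a, ∃ j, udRow a ⬝ᵥ q j = m a := fun a => by
    obtain ⟨j, -, hj⟩ := Finset.exists_mem_eq_sup' Finset.univ_nonempty
      (fun j : Fin (K + 1) => udRow a ⬝ᵥ q j)
    exact ⟨j, hj.symm⟩
  have hmq : ∀ a j, udRow a ⬝ᵥ q j ≤ m a := fun a j =>
    Finset.le_sup' (fun j : Fin (K + 1) => udRow a ⬝ᵥ q j) (Finset.mem_univ j)
  have hm : ∀ a, ∀ y ∈ convexHull ℝ (Set.range q), udRow a ⬝ᵥ y ≤ m a := fun a =>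
    dot_le_of_mem_convexHull _ _ _ (by rintro _ ⟨j, rfl⟩; exact hmq a j)
  have hq : ∀ j, q j ∈ convexHull ℝ (Set.range q) := fun j => subset_convexHull ℝ _ ⟨j, rfl⟩
  -- (1) the recourse matrix factors through `Option (Fin r)`
  obtain ⟨γ, δ, hγ, hδ, hfacQ⟩ := hQ.exists_nonneg_factorization q hq udRow m hm
  -- (2) the augmented slack of `COR + Q` factors through `Option (Fin r)`
  have hv : ∀ p : Finset (Fin n) × Fin (K + 1),
      udPt p.1 + q p.2 ∈ corPolytope n + convexHull ℝ (Set.range q) :=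
    fun p => Set.add_mem_add (pt_mem p.1) (hq p.2)
  have hvalid : ∀ a, ∀ x ∈ corPolytope n + convexHull ℝ (Set.range q), udRow a ⬝ᵥ x ≤ 1 + m a := by
    rintro a x ⟨p, hp, y, hy, rfl⟩
    rw [dotProduct_add]
    exact add_le_add (cc_valid a p hp) (hm a y hy)
  obtain ⟨U, V, hU, hV, hfacR⟩ := hR.exists_nonneg_factorization
    (fun p : Finset (Fin n) × Fin (K + 1) => udPt p.1 + q p.2) hv udRow (fun a => 1 + m a) hvalid
  -- (3) the law, applied to `G(a,j) := m a − ⟨udRow a, q j⟩`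
  rcases lt_or_ge (T c n) r with hlt | hge
  · exact hlt
  · have key := hn₀ n hn (Fin (K + 1)) (Option (Fin r)) (Option (Fin r)) (fun a j => m a - udRow a ⬝ᵥ q j)
      (fun a => by obtain ⟨j, hj⟩ := hmax a; exact ⟨j, by rw [hj, sub_self]⟩)
      ⟨γ, δ, hγ, hδ, fun a j => hfacQ a j⟩
      ⟨U, V, hU, hV, fun a b j => by rw [← slack a b, ← hfacR a (b, j), dotProduct_add]; ring⟩
      (by simp [Fintype.card_option, Fintype.card_fin]; omega)
    simp [Fintype.card_option, Fintype.card_fin] at key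
    omega

/-- **COR-VIRTUAL, graph currency** — verbatim `XcDivision.VPLine.CorVirtualHard` of `Lines/virtual_passenger.lean`
(`Iff.rfl` once that module is importable). -/
def CorVirtualHard : Prop :=
  ∀ c : ℕ, ∃ h₀ : ℕ, ∀ h ≥ h₀, ∀ (K : ℕ) (q : Fin (K + 1) → (Fin h × Fin h → ℝ)) (r : ℕ),
    HasEFOfSize (convexHull ℝ (Set.range q)) r →
    HasEFOfSize (corPolytopeGraph (⊤ : SimpleGraph (Fin h)) + convexHull ℝ (Set.range q)) r → T c h < r

/-- ★ **matrix law ⇒ COR-VIRTUAL (graph currency `corPolytopeGraph ⊤`).** -/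
theorem corVirtualHard_of_matrixLaw (hL : InteractionMatrixLaw) : CorVirtualHard := by
  intro c
  obtain ⟨h₀, hh₀⟩ := corVirtualHardN_of_matrixLaw hL c
  refine ⟨h₀, fun h hh K q r hQ hR => ?_⟩
  let e : (Fin h × Fin h → ℝ) ≃ₗ[ℝ] (Fin (h * h) → ℝ) :=
    LinearEquiv.funCongrLeft ℝ ℝ (finProdFinEquiv (m := h) (n := h)).symm
  have hQimg : e '' convexHull ℝ (Set.range q) = convexHull ℝ (Set.range (e ∘ q)) := by
    rw [Set.range_comp]; exact e.toLinearMap.image_convexHull (Set.range q)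
  have himg : e '' (corPolytopeGraph (⊤ : SimpleGraph (Fin h)) + convexHull ℝ (Set.range q)) =
      corPolytope h + convexHull ℝ (Set.range (e ∘ q)) := by
    rw [Set.image_add, corPolytope_eq_image_corPolytopeGraph_top, hQimg]
  have hR' : HasEFOfSize (corPolytope h + convexHull ℝ (Set.range (e ∘ q))) r := by
    rw [← himg]; exact (HasEFOfSize.image_linearEquiv_iff e).2 hR
  have hQ' : HasEFOfSize (convexHull ℝ (Set.range (e ∘ q))) r := by
    rw [← hQimg]; exact (HasEFOfSize.image_linearEquiv_iff e).2 hQ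
  exact hh₀ h hh K (e ∘ q) r hR' hQ'

end MatrixLaw

end Summit.ValiantsHypothesis.ValiantsHypothesis.Cruxes.NNDivisionHard.RecourseGraph
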